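import Literature.Geometry.Manifold.SubanalyticSets
import HarnessLib

/-!
# Subanalytic sets: linear images and products

Topic `Geometry/Manifold`; sequel to `SubanalyticSets.lean` (Hironaka 1975, Def. 3.1 / 3.3:
`IsSemianalytic`, `IsSubanalytic`, through the germ scheme `IsLocallyInBooleanClosure`), part of
the programme towards `Literature.Geometry.Riemannian.buchner1977_cutLocus_triangulable` (Buchner
1977 manipulates products, fibre products and images of semi- and subanalytic sets, pp. 119–120).
Proved here:

* `exists_mem_closure_inter_eq_of_forall` — **germ transfer**: if every generator `s ∈ S` agrees on
  a window `W` with some member of the Boolean closure of `T`, then so does every member of the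
  Boolean closure of `S` (induction on the closure; Boolean operations commute with restriction
  to `W`) — the bookkeeping behind all "change of presentation" arguments;
* `IsSubanalytic.image_equiv` — images of subanalytic sets under continuous linear equivalences
  are subanalytic;
* `IsSubanalytic.prod` — **products of subanalytic subsets of finite-dimensional spaces are
  subanalytic** (`f(C) × f'(C')` is not a generator, the factors being unbounded, but on a bounded
  window `P × P'` around the point it agrees with the generator `(f × e⁻¹)(C × Q)`, `Q` a bounded
  analytic ball; germ transfer does the rest).

No definitions, no named facts (D-0026).

## References

* [Hironaka1975] H. Hironaka, Triangulations of algebraic sets, PSPM 29 (1975), Def. 3.1, Def. 3.3.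
* [Buchner1977Simplicial] M. A. Buchner, Proc. AMS 64 (1977), pp. 119–120.
-/

noncomputable section

open Set Function Filter
open scoped Topology

namespace Literature.Geometry.Manifold

/-! ### Germ transfer between generating families -/

section Transfer

variable {X : Type*}

/-- **Germ transfer.** Let `S, T` be families of subsets of `X` and `W ⊆ X` a "window". If every
`s ∈ S` agrees on `W` with some member of the Boolean closure of `T`, then every member of the
Boolean closure of `S` agrees on `W` with some member of the Boolean closure of `T` (Boolean
operations commute with `· ∩ W`). [folklore] -/
theorem exists_mem_closure_inter_eq_of_forall {S T : Set (Set X)} {W : Set X}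
    (h : ∀ s ∈ S, ∃ t ∈ BooleanSubalgebra.closure T, s ∩ W = t ∩ W) {B : Set X}
    (hB : B ∈ BooleanSubalgebra.closure S) :
    ∃ t ∈ BooleanSubalgebra.closure T, B ∩ W = t ∩ W := by
  induction hB using BooleanSubalgebra.closure_bot_sup_induction with
  | mem s hs => exact h s hs
  | bot => exact ⟨⊥, BooleanSubalgebra.bot_mem, rfl⟩
  | sup s _ s' _ hs hs' =>
    obtain ⟨t, ht, hst⟩ := hs
    obtain ⟨t', ht', hst'⟩ := hs'
    refine ⟨t ⊔ t', BooleanSubalgebra.sup_mem ht ht', ?_⟩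
    show (s ∪ s') ∩ W = (t ∪ t') ∩ W
    rw [union_inter_distrib_right, union_inter_distrib_right, hst, hst']
  | compl s _ hs =>
    obtain ⟨t, ht, hst⟩ := hs
    refine ⟨tᶜ, BooleanSubalgebra.compl_mem ht, ?_⟩
    ext ξ
    constructor
    · rintro ⟨hξs, hξW⟩
      refine ⟨fun hξt => hξs ?_, hξW⟩
      exact ((hst.symm.subset : t ∩ W ⊆ s ∩ W) ⟨hξt, hξW⟩).1
    · rintro ⟨hξt, hξW⟩
      refine ⟨fun hξs => hξt ?_, hξW⟩
      exact ((hst.subset : s ∩ W ⊆ t ∩ W) ⟨hξs, hξW⟩).1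

/-- Restriction of a germ equality to a smaller window. [folklore] -/
theorem inter_eq_inter_of_subset {A B W W' : Set X} (h : A ∩ W = B ∩ W) (hW : W' ⊆ W) :
    A ∩ W' = B ∩ W' := by
  ext ξ
  constructor
  · rintro ⟨hξA, hξW'⟩
    exact ⟨((h.subset : A ∩ W ⊆ B ∩ W) ⟨hξA, hW hξW'⟩).1, hξW'⟩
  · rintro ⟨hξB, hξW'⟩
    exact ⟨((h.symm.subset : B ∩ W ⊆ A ∩ W) ⟨hξB, hW hξW'⟩).1, hξW'⟩

end Transfer

/-! ### Linear images of subanalytic sets -/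

section Image

variable {E : Type*} [NormedAddCommGroup E] [NormedSpace ℝ E]
  {F : Type*} [NormedAddCommGroup F] [NormedSpace ℝ F]

/-- **Images of subanalytic sets under continuous linear equivalences are subanalytic**:
generators `f(C)` go to generators `(e ∘ f)(C)`, neighbourhoods and Boolean combinations are
transported by the preimage under `e⁻¹`. [folklore] -/
theorem IsSubanalytic.image_equiv {A : Set E} (hA : IsSubanalytic A) (e : E ≃L[ℝ] F) :
    IsSubanalytic (e '' A) := by
  intro y
  obtain ⟨U, hU, hx, S, hSf, hSg, B, hB, hAB⟩ := hA (e.symm y)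
  have himg : ∀ s : Set E, (e : E → F) '' s = (e.symm : F → E) ⁻¹' s := fun s =>
    e.toEquiv.image_eq_preimage_symm s
  refine ⟨e '' U, ?_, ⟨e.symm y, hx, by simp⟩, (fun s => e '' s) '' S, hSf.image _, ?_, e '' B,
    ?_, ?_⟩
  · rw [himg]
    exact hU.preimage e.symm.continuous
  · rintro _ ⟨s, hs, rfl⟩
    obtain ⟨m, C, f, hC, hCb, hf, rfl⟩ := hSg hs
    refine ⟨m, C, e ∘ f, hC, hCb, fun z _ => ((e : E →L[ℝ] F).analyticAt (f z)).comp (hf z (mem_univ z)),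
      ?_⟩
    rw [image_comp]
  · rw [himg]
    have h := preimage_mem_closure_of_mem_closure (e.symm : F → E) hB
    convert h using 2
    ext s
    simp only [mem_image, himg]
  · simp only [himg]
    rw [← preimage_inter, ← preimage_inter, hAB]

end Image

/-! ### Products of subanalytic sets -/

section Prod

variable {E : Type*} [NormedAddCommGroup E] [NormedSpace ℝ E] [FiniteDimensional ℝ E]
  {F : Type*} [NormedAddCommGroup F] [NormedSpace ℝ F] [FiniteDimensional ℝ F]

/-- A bounded open semi-analytic neighbourhood of a point of a finite-dimensional space (the
preimage of a Euclidean polynomial ball under a linear isomorphism with `ℝⁿ`). [folklore] -/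
theorem exists_isSemianalytic_isBounded_nhds (x : E) :
    ∃ P : Set E, IsSemianalytic P ∧ IsOpen P ∧ x ∈ P ∧ Bornology.IsBounded P := by
  set n : ℕ := Module.finrank ℝ E
  have hdim : Module.finrank ℝ E = Module.finrank ℝ (Fin n → ℝ) := by
    rw [Module.finrank_fin_fun]
  set e : E ≃L[ℝ] (Fin n → ℝ) := ContinuousLinearEquiv.ofFinrankEq hdim
  obtain ⟨hPs, hPo, hxP, hPb⟩ := polyBall_props (e x)
  refine ⟨e ⁻¹' {ξ | ∑ i, (ξ i - e x i) ^ 2 < 1}, ?_, hPo.preimage e.continuous, hxP, ?_⟩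
  · exact hPs.preimage fun z _ => (e : E →L[ℝ] (Fin n → ℝ)).analyticAt z
  · have h : e ⁻¹' {ξ | ∑ i, (ξ i - e x i) ^ 2 < 1} =
        (e.symm : (Fin n → ℝ) → E) '' {ξ | ∑ i, (ξ i - e x i) ^ 2 < 1} := by
      ext z
      constructor
      · intro hz
        exact ⟨e z, hz, e.symm_apply_apply z⟩
      · rintro ⟨w, hw, rfl⟩
        simpa using hw
    rw [h]
    exact (e.symm : (Fin n → ℝ) →L[ℝ] E).lipschitz.isBounded_image hPb

omit [FiniteDimensional ℝ E] in
/-- The generator `f(C)`, restricted to a bounded semi-analytic window `P'` in a second factor, is a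
product generator: `f(C) ×ˢ P' = g(D)` for the entire analytic map
`g = (f ∘ pr₁, e'⁻¹ ∘ pr₂) ∘ κ⁻¹` and the bounded semi-analytic set `D = κ(C × e'(P'))`, `κ` the
concatenation isomorphism `ℝᵐ × ℝ^{n'} ≅ ℝ^{m+n'}`, `e'` a linear isomorphism `F ≅ ℝ^{n'}`.
[folklore] -/
theorem prod_mem_subanalyticGen {m : ℕ} {C : Set (Fin m → ℝ)} (hC : IsSemianalytic C)
    (hCb : Bornology.IsBounded C) {f : (Fin m → ℝ) → E} (hf : AnalyticOnNhd ℝ f univ)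
    {P' : Set F} (hP' : IsSemianalytic P') (hP'b : Bornology.IsBounded P') (U : Set (E × F)) :
    (f '' C) ×ˢ P' ∈ subanalyticGen (E × F) U := by
  set n' : ℕ := Module.finrank ℝ F
  have hdim : Module.finrank ℝ F = Module.finrank ℝ (Fin n' → ℝ) := by
    rw [Module.finrank_fin_fun]
  set e' : F ≃L[ℝ] (Fin n' → ℝ) := ContinuousLinearEquiv.ofFinrankEq hdim
  -- the concatenation isomorphism `ℝᵐ × ℝ^{n'} ≅ ℝ^{m + n'}`
  have hdim2 : Module.finrank ℝ ((Fin m → ℝ) × (Fin n' → ℝ)) =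
      Module.finrank ℝ (Fin (m + n') → ℝ) := by
    rw [Module.finrank_prod, Module.finrank_fin_fun, Module.finrank_fin_fun, Module.finrank_fin_fun]
  set κ : ((Fin m → ℝ) × (Fin n' → ℝ)) ≃L[ℝ] (Fin (m + n') → ℝ) :=
    ContinuousLinearEquiv.ofFinrankEq hdim2
  set D : Set (Fin (m + n') → ℝ) := κ '' (C ×ˢ (e' '' P'))
  set g : (Fin (m + n') → ℝ) → E × F := fun z => (f (κ.symm z).1, e'.symm (κ.symm z).2)
  refine ⟨m + n', D, g, ?_, ?_, ?_, ?_⟩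
  · exact (hC.prod (hP'.image_equiv e')).image_equiv κ
  · exact (κ : ((Fin m → ℝ) × (Fin n' → ℝ)) →L[ℝ] (Fin (m + n') → ℝ)).lipschitz.isBounded_image
      (hCb.prod ((e' : F →L[ℝ] (Fin n' → ℝ)).lipschitz.isBounded_image hP'b))
  · intro z _
    have hκ : AnalyticAt ℝ (κ.symm : (Fin (m + n') → ℝ) → (Fin m → ℝ) × (Fin n' → ℝ)) z :=
      (κ.symm : (Fin (m + n') → ℝ) →L[ℝ] ((Fin m → ℝ) × (Fin n' → ℝ))).analyticAt z
    refine AnalyticAt.prod ?_ ?_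
    · exact (hf _ (mem_univ _)).comp (analyticAt_fst.comp hκ)
    · exact ((e'.symm : (Fin n' → ℝ) →L[ℝ] F).analyticAt _).comp (analyticAt_snd.comp hκ)
  · -- `f(C) × P' = g(D)`
    ext ⟨u, v⟩
    simp only [mem_prod, mem_image, D, g]
    constructor
    · rintro ⟨⟨c, hc, rfl⟩, hv⟩
      refine ⟨κ (c, e' v), ⟨(c, e' v), ⟨hc, v, hv, rfl⟩, rfl⟩, ?_⟩
      simp
    · rintro ⟨z, ⟨⟨c, w⟩, ⟨hc, v', hv', hw⟩, rfl⟩, h⟩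
      simp only [ContinuousLinearEquiv.symm_apply_apply, Prod.mk.injEq] at h
      obtain ⟨rfl, rfl⟩ := h
      subst hw
      exact ⟨⟨c, hc, rfl⟩, by simpa using hv'⟩

/-- **Products of subanalytic subsets of finite-dimensional spaces are subanalytic.** At
`(x, x')` present `A` near `x` on `U` through generators `S` and a Boolean combination `B`, and
`A'` near `x'` likewise; shrink to bounded semi-analytic windows `P ∋ x`, `P' ∋ x'`. On the window
`W = P × P'` each `pr₁⁻¹(f(C))` agrees with the product generator `f(C) × P'`
(`prod_mem_subanalyticGen`) and each `pr₂⁻¹(f'(C'))` with `P × f'(C')`; by germ transfer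
(`exists_mem_closure_inter_eq_of_forall`) `pr₁⁻¹ B` and `pr₂⁻¹ B'` agree on `W` with Boolean
combinations of product generators, hence so does `B × B'`, which agrees with `A × A'` on
`U × U'`. [folklore] -/
theorem IsSubanalytic.prod {A : Set E} {A' : Set F} (hA : IsSubanalytic A) (hA' : IsSubanalytic A') :
    IsSubanalytic (A ×ˢ A') := by
  rintro ⟨x, x'⟩
  obtain ⟨U, hU, hx, S, hSf, hSg, B, hB, hAB⟩ := hA x
  obtain ⟨U', hU', hx', S', hS'f, hS'g, B', hB', hAB'⟩ := hA' x'
  obtain ⟨P, hPs, hPo, hxP, hPb⟩ := exists_isSemianalytic_isBounded_nhds x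
  obtain ⟨P', hP's, hP'o, hxP', hP'b⟩ := exists_isSemianalytic_isBounded_nhds x'
  -- the product generators over the window `W = P × P'`
  set W : Set (E × F) := P ×ˢ P' with hW
  set V : Set (E × F) := (U ∩ P) ×ˢ (U' ∩ P') with hV
  set T : Set (Set (E × F)) :=
    ((fun s => s ×ˢ P') '' S) ∪ ((fun s' => P ×ˢ s') '' S') with hT
  have hTf : T.Finite := (hSf.image _).union (hS'f.image _)
  have hTg : T ⊆ subanalyticGen (E × F) V := by
    rintro t (⟨s, hs, rfl⟩ | ⟨s', hs', rfl⟩)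
    · obtain ⟨m, C, f, hC, hCb, hf, rfl⟩ := hSg hs
      exact prod_mem_subanalyticGen hC hCb hf hP's hP'b V
    · obtain ⟨m, C, f, hC, hCb, hf, rfl⟩ := hS'g hs'
      -- swap the factors: `P × f(C)` is the image of `f(C) × P` under the swap isomorphism
      have h := prod_mem_subanalyticGen (E := F) (F := E) hC hCb hf hPs hPb
        ((ContinuousLinearEquiv.prodComm ℝ E F) '' V)
      obtain ⟨m', D, g, hD, hDb, hg, hgD⟩ := h
      refine ⟨m', D, (ContinuousLinearEquiv.prodComm ℝ F E) ∘ g, hD, hDb,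
        fun z _ => ((ContinuousLinearEquiv.prodComm ℝ F E : (F × E) →L[ℝ] E × F).analyticAt _).comp
          (hg z (mem_univ z)), ?_⟩
      rw [image_comp, ← hgD]
      ext ⟨u, v⟩
      simp [and_comm]
  -- germ transfer for the two factors
  have h1 : ∀ s ∈ (fun s => Prod.fst ⁻¹' s) '' S, ∃ t ∈ BooleanSubalgebra.closure T,
      s ∩ W = t ∩ W := by
    rintro _ ⟨s, hs, rfl⟩
    refine ⟨s ×ˢ P', BooleanSubalgebra.subset_closure (Or.inl ⟨s, hs, rfl⟩), ?_⟩
    ext ⟨u, v⟩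
    simp only [hW, mem_inter_iff, mem_preimage, mem_prod]
    tauto
  have h2 : ∀ s' ∈ (fun s' => Prod.snd ⁻¹' s') '' S', ∃ t ∈ BooleanSubalgebra.closure T,
      s' ∩ W = t ∩ W := by
    rintro _ ⟨s', hs', rfl⟩
    refine ⟨P ×ˢ s', BooleanSubalgebra.subset_closure (Or.inr ⟨s', hs', rfl⟩), ?_⟩
    ext ⟨u, v⟩
    simp only [hW, mem_inter_iff, mem_preimage, mem_prod]
    tauto
  obtain ⟨t₁, ht₁, hBt₁⟩ := exists_mem_closure_inter_eq_of_forall h1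
    (preimage_mem_closure_of_mem_closure Prod.fst hB)
  obtain ⟨t₂, ht₂, hBt₂⟩ := exists_mem_closure_inter_eq_of_forall h2
    (preimage_mem_closure_of_mem_closure Prod.snd hB')
  refine ⟨V, (hU.inter hPo).prod (hU'.inter hP'o), ⟨⟨hx, hxP⟩, ⟨hx', hxP'⟩⟩, T, hTf, hTg,
    t₁ ∩ t₂, BooleanSubalgebra.inf_mem ht₁ ht₂, ?_⟩
  -- `(A × A') ∩ V = (t₁ ∩ t₂) ∩ V`
  have hVW : V ⊆ W := prod_mono inter_subset_right inter_subset_right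
  have hBt₁' := inter_eq_inter_of_subset hBt₁ hVW
  have hBt₂' := inter_eq_inter_of_subset hBt₂ hVW
  have hAV : (A ×ˢ A') ∩ V = (B ×ˢ B') ∩ V := by
    ext ⟨u, v⟩
    simp only [hV, mem_inter_iff, mem_prod]
    constructor
    · rintro ⟨⟨huA, hvA⟩, ⟨huU, huP⟩, ⟨hvU, hvP⟩⟩
      exact ⟨⟨((hAB.subset : A ∩ U ⊆ B ∩ U) ⟨huA, huU⟩).1,
        ((hAB'.subset : A' ∩ U' ⊆ B' ∩ U') ⟨hvA, hvU⟩).1⟩, ⟨huU, huP⟩, ⟨hvU, hvP⟩⟩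
    · rintro ⟨⟨huB, hvB⟩, ⟨huU, huP⟩, ⟨hvU, hvP⟩⟩
      exact ⟨⟨((hAB.symm.subset : B ∩ U ⊆ A ∩ U) ⟨huB, huU⟩).1,
        ((hAB'.symm.subset : B' ∩ U' ⊆ A' ∩ U') ⟨hvB, hvU⟩).1⟩, ⟨huU, huP⟩, ⟨hvU, hvP⟩⟩
  rw [hAV]
  have hprod : (B ×ˢ B' : Set (E × F)) = Prod.fst ⁻¹' B ∩ Prod.snd ⁻¹' B' := prod_eq B B'
  rw [hprod, inter_inter_distrib_right, hBt₁', hBt₂', ← inter_inter_distrib_right]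

end Prod

end Literature.Geometry.Manifold

end
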